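import Summits.SmoothPoincare4.SmoothPoincare4.Theses.EntropyRung
import Summits.SmoothPoincare4.SmoothPoincare4.Theorems.SubcylindricalExistence.Negative.Logic
import Summits.SmoothPoincare4.SmoothPoincare4.Theorems.SubcylindricalExistence.Negative.Window
import Summits.SmoothPoincare4.SmoothPoincare4.Theorems.EntropyRungSubcylindricalExistenceTransport

/-!
# Strategy census — the TYPED attempts (crux-strategist wall-breaker pass, gen 1, 2026-08-17)
# crux stmt-SmoothPoincare4-10871 `EntropyRung.SubcylindricalExistence` (ENT)

Companion to `STRATEGY-CENSUS.md` (same crux directory). Everything here is proved (no `sorry`,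
no definition of mathematical content beyond Prop abbreviations, no named fact). Sections:

* §1 DECOMPOSITION D1 — `ENT ↔ PscSphereExistence ∧ EntropyUpgrade` (exact split of the crux into
  its PSC conjunct and the conditional entropy upgrade), and the reason it is NOT filed:
  `entropyUpgrade_iff_spc4Psc` — GIVEN THE RUNG ALONE the entropy half is equivalent to
  `Spc4Psc` ("every smooth homotopy 4-sphere admitting a PSC metric is diffeomorphic to `S⁴`"),
  a RECOGNITION statement that makes the route's own rung a corollary (`rung_of_spc4Psc`); the split
  is `SPC4 ↔ PSC-existence ∧ PSC-recognition` (`spc4_iff_psc_and_spc4Psc`), i.e. a different route,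
  not a decomposition of this crux.
* §2 STRENGTHEN S1 — `NearRoundEntropy` (PSC metrics with `ν ≥ ν_round − ε` for every `ε > 0`)
  implies ENT (`δ`-arithmetic from the certified window `Negative.margin_gt`); recorded as harder with
  no added rigidity.
* §3 NUMBERS behind two diagnoses: the Jensen/Yamabe entropy floor at the round Yamabe constant,
  `2 log (Y(S⁴)/12π) − 2 = log (8/3) − 2 < −1 < ν_cyl` (`jensenYamabeFloor_lt`), and the surgery-cost
  lattice `ν_sheet < ν_cyl < ν_round` (`Negative.nuSheet_lt_nuCyl`, `Negative.nuCyl_lt_nuRound`).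
[folklore]
-/

noncomputable section

-- the crux-folder namespace repeats the summit component (`Summit.SmoothPoincare4.SmoothPoincare4.…`)
set_option linter.dupNamespace false

open scoped Manifold ContDiff ContinuousMap
open MeasureTheory Set Literature.Geometry.Lorentzian
open Summit.SmoothPoincare4.SmoothPoincare4.Theses.EntropyRung

namespace Summit.SmoothPoincare4.SmoothPoincare4.Cruxes.SubcylindricalExistence.StrategyCensus

/-! ## §1 Decomposition D1: PSC conjunct ∧ conditional entropy upgrade -/

/-- **PSC-existence on homotopy 4-spheres**, over ENT's own binders (= the conclusion shape of
`Negative.psc_of_subcylindricalExistence`; same content as route PIC's crux `PicPscV2`,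
stmt-SmoothPoincare4-0442, which is stated over `HomotopySphere 4`). Open; SPC4-implied. -/
def PscSphereExistence : Prop :=
  ∀ (M : Type) [TopologicalSpace M] [T2Space M] [SecondCountableTopology M]
    [ChartedSpace (EuclideanSpace ℝ (Fin 4)) M] [IsManifold (𝓡 4) ∞ M] [CompactSpace M] [T3Space M]
    [MeasurableSpace M] [BorelSpace M],
    M ≃ₕ Metric.sphere (0 : EuclideanSpace ℝ (Fin 5)) 1 →
    ∃ g : PseudoRiemannianMetric (𝓡 4) ∞ (EuclideanSpace ℝ (Fin 4)) (TangentSpace (𝓡 4) : M → Type _),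
      ∃ _ : g.HasLeviCivita, ∃ _ : g.IsRiemannian, ∀ x : M, 0 < g.scalarCurvature x

/-- ENT's full conclusion for one `M` (the `∃ g …` clause of `SubcylindricalExistence`), as an
abbreviation. -/
def EntConclusion (M : Type) [TopologicalSpace M] [T2Space M] [SecondCountableTopology M]
    [ChartedSpace (EuclideanSpace ℝ (Fin 4)) M] [IsManifold (𝓡 4) ∞ M] [CompactSpace M] [T3Space M]
    [MeasurableSpace M] [BorelSpace M] : Prop :=
  ∃ g : PseudoRiemannianMetric (𝓡 4) ∞ (EuclideanSpace ℝ (Fin 4)) (TangentSpace (𝓡 4) : M → Type _),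
    ∃ _ : g.HasLeviCivita, ∃ hg : g.IsRiemannian, (∀ x : M, 0 < g.scalarCurvature x) ∧
      ∃ δ : ℝ, 0 < δ ∧ ∀ τ : ℝ, 0 < τ → ∀ f : M → ℝ, ContMDiff (𝓡 4) 𝓘(ℝ, ℝ) ∞ f →
        ∫ x, (4 * Real.pi * τ) ^ (-(4 : ℝ) / 2) * Real.exp (-f x)
          ∂(riemannianMeasure (g.toContMDiffRiemannianMetric hg)) = 1 →
        Real.log 2 + Real.log Real.pi / 2 - 3 / 2 + δ ≤
          ∫ x, (τ * (g.scalarCurvature x + g.gradSq f x) + f x - 4) *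
            ((4 * Real.pi * τ) ^ (-(4 : ℝ) / 2) * Real.exp (-f x))
            ∂(riemannianMeasure (g.toContMDiffRiemannianMetric hg))

/-- The crux is literally `∀ M …, M ≃ₕ S⁴ → EntConclusion M`. -/
theorem subcylindricalExistence_iff_forall_entConclusion :
    SubcylindricalExistence ↔
      ∀ (M : Type) [TopologicalSpace M] [T2Space M] [SecondCountableTopology M]
        [ChartedSpace (EuclideanSpace ℝ (Fin 4)) M] [IsManifold (𝓡 4) ∞ M] [CompactSpace M] [T3Space M]
        [MeasurableSpace M] [BorelSpace M],
        M ≃ₕ Metric.sphere (0 : EuclideanSpace ℝ (Fin 5)) 1 → EntConclusion M :=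
  Iff.rfl

/-- **Conditional entropy upgrade**: a homotopy 4-sphere that carries SOME PSC metric carries a PSC
metric with `ν > ν_cyl`. The second piece of split D1. -/
def EntropyUpgrade : Prop :=
  ∀ (M : Type) [TopologicalSpace M] [T2Space M] [SecondCountableTopology M]
    [ChartedSpace (EuclideanSpace ℝ (Fin 4)) M] [IsManifold (𝓡 4) ∞ M] [CompactSpace M] [T3Space M]
    [MeasurableSpace M] [BorelSpace M],
    M ≃ₕ Metric.sphere (0 : EuclideanSpace ℝ (Fin 5)) 1 →
    (∃ g : PseudoRiemannianMetric (𝓡 4) ∞ (EuclideanSpace ℝ (Fin 4)) (TangentSpace (𝓡 4) : M → Type _),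
      ∃ _ : g.HasLeviCivita, ∃ _ : g.IsRiemannian, ∀ x : M, 0 < g.scalarCurvature x) →
    EntConclusion M

/-- **PSC-recognition** ("SPC4 for PSC homotopy 4-spheres"): a smooth homotopy 4-sphere admitting a
PSC metric is diffeomorphic to `S⁴`. A recognition statement with a WEAKER hypothesis than the rung
`SubcylindricalRecognition` (no entropy clause), hence a stronger claim. Open. -/
def Spc4Psc : Prop :=
  ∀ (M : Type) [TopologicalSpace M] [T2Space M] [SecondCountableTopology M]
    [ChartedSpace (EuclideanSpace ℝ (Fin 4)) M] [IsManifold (𝓡 4) ∞ M] [CompactSpace M] [T3Space M]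
    [MeasurableSpace M] [BorelSpace M],
    M ≃ₕ Metric.sphere (0 : EuclideanSpace ℝ (Fin 5)) 1 →
    (∃ g : PseudoRiemannianMetric (𝓡 4) ∞ (EuclideanSpace ℝ (Fin 4)) (TangentSpace (𝓡 4) : M → Type _),
      ∃ _ : g.HasLeviCivita, ∃ _ : g.IsRiemannian, ∀ x : M, 0 < g.scalarCurvature x) →
    Nonempty (M ≃ₘ⟮𝓡 4, 𝓡 4⟯ (Metric.sphere (0 : EuclideanSpace ℝ (Fin 5)) 1))

/-- The split glue: `PscSphereExistence → EntropyUpgrade → ENT` (modus ponens per `M`). -/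
theorem subcylindricalExistence_of_psc_of_upgrade (hP : PscSphereExistence) (hU : EntropyUpgrade) :
    SubcylindricalExistence := by
  intro M _ _ _ _ _ _ _ _ _ e
  exact hU M e (hP M e)

/-- Converse bookkeeping 1: ENT contains its PSC conjunct (= `Negative.psc_of_subcylindricalExistence`). -/
theorem psc_of_subcylindricalExistence (h : SubcylindricalExistence) : PscSphereExistence := by
  intro M _ _ _ _ _ _ _ _ _ e
  obtain ⟨g, hLC, hg, hR, -⟩ := h M e
  exact ⟨g, hLC, hg, hR⟩

/-- Converse bookkeeping 2: ENT trivially gives the conditional upgrade. -/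
theorem entropyUpgrade_of_subcylindricalExistence (h : SubcylindricalExistence) : EntropyUpgrade := by
  intro M _ _ _ _ _ _ _ _ _ e _
  exact h M e

/-- **D1 is an exact split**: `ENT ↔ PscSphereExistence ∧ EntropyUpgrade` (no slack lost). -/
theorem subcylindricalExistence_iff_psc_and_upgrade :
    SubcylindricalExistence ↔ PscSphereExistence ∧ EntropyUpgrade :=
  ⟨fun h ↦ ⟨psc_of_subcylindricalExistence h, entropyUpgrade_of_subcylindricalExistence h⟩,
    fun h ↦ subcylindricalExistence_of_psc_of_upgrade h.1 h.2⟩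

/-- **Why D1 is not filed (a): the entropy half is PSC-recognition in costume, direction 1.**
`Spc4Psc → EntropyUpgrade` UNCONDITIONALLY: recognise `M ≅ S⁴` from the PSC metric, then transport the
round witness (`Theorems.subcylindricalClause_of_diffeomorph`, p96669). -/
theorem entropyUpgrade_of_spc4Psc (h : Spc4Psc) : EntropyUpgrade := by
  intro M _ _ _ _ _ _ _ _ _ e hPSC
  obtain ⟨Φ⟩ := h M e hPSC
  exact Summit.SmoothPoincare4.SmoothPoincare4.Theorems.subcylindricalClause_of_diffeomorph Φ

/-- **Why D1 is not filed (b): direction 2, given the rung alone.** `EntropyUpgrade → Spc4Psc` modulo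
`SubcylindricalRecognition`: upgrade the PSC metric, then apply the rung. -/
theorem spc4Psc_of_entropyUpgrade (hRung : SubcylindricalRecognition) (hU : EntropyUpgrade) :
    Spc4Psc := by
  intro M _ _ _ _ _ _ _ _ _ e hPSC
  obtain ⟨g, hLC, hg, hR, hν⟩ := hU M e hPSC
  exact hRung M e g hg hR hν

/-- **The diagnosis of D1, kernel form**: given the route's rung, the entropy half of the split is
EQUIVALENT to PSC-recognition `Spc4Psc`. So D1 rewrites the crux as `PSC-existence ∧ PSC-recognition`,
in which entropy plays no role. -/
theorem entropyUpgrade_iff_spc4Psc (hRung : SubcylindricalRecognition) : EntropyUpgrade ↔ Spc4Psc :=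
  ⟨spc4Psc_of_entropyUpgrade hRung, entropyUpgrade_of_spc4Psc⟩

/-- … and PSC-recognition makes the rung itself a corollary (drop the entropy hypothesis). -/
theorem rung_of_spc4Psc (h : Spc4Psc) : SubcylindricalRecognition := by
  intro M _ _ _ _ _ _ _ _ _ e g _ hg hR _
  exact h M e ⟨g, ‹g.HasLeviCivita›, hg, hR⟩

/-- The summit through D1's pieces: `PscSphereExistence → Spc4Psc → SmoothPoincare4` (packaging of the
summit binder exactly as in the route's `closes`). -/
theorem spc4_of_psc_of_spc4Psc (hP : PscSphereExistence) (hS : Spc4Psc) : _root_.SmoothPoincare4 := by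
  intro M _ _ _ _ _ e
  haveI : CompactSpace M :=
    Literature.Topology.FourManifolds.compactSpace_of_homotopyEquiv_sphere_four_holds M e
  letI : MeasurableSpace M := borel M
  haveI : BorelSpace M := ⟨rfl⟩
  exact hS M e (hP M e)

/-- **`SPC4 ↔ PSC-existence ∧ PSC-recognition`** — what D1 really is: a decomposition of the SUMMIT by
the curvature condition `R > 0`, independent of this route's entropy thesis. [folklore] -/
theorem spc4_iff_psc_and_spc4Psc : _root_.SmoothPoincare4 ↔ PscSphereExistence ∧ Spc4Psc := by
  refine ⟨fun h ↦ ⟨?_, ?_⟩, fun h ↦ spc4_of_psc_of_spc4Psc h.1 h.2⟩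
  · exact psc_of_subcylindricalExistence
      (Summit.SmoothPoincare4.SmoothPoincare4.Theorems.subcylindricalExistence_of_spc4 h)
  · intro M _ _ _ _ _ _ _ _ _ e _
    exact h M ‹ChartedSpace (EuclideanSpace ℝ (Fin 4)) M› ‹IsManifold (𝓡 4) ∞ M› e

/-- Both D1 pieces are SPC4-implied (so neither is refutable short of an exotic `S⁴`). -/
theorem d1_pieces_of_spc4 (h : _root_.SmoothPoincare4) : PscSphereExistence ∧ EntropyUpgrade :=
  subcylindricalExistence_iff_psc_and_upgrade.1
    (Summit.SmoothPoincare4.SmoothPoincare4.Theorems.subcylindricalExistence_of_spc4 h)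

/-! ## §2 Strengthen S1: near-round entropy -/

/-- **Near-round entropy existence** (strengthening S1): every smooth homotopy 4-sphere carries, for
every `ε > 0`, a PSC metric with `𝒲 ≥ ν_round − ε = log 6 − 2 − ε` at all scales. Harder than ENT
(ENT needs one `ε < 0.026`), with no added rigidity to exploit. -/
def NearRoundEntropy : Prop :=
  ∀ (M : Type) [TopologicalSpace M] [T2Space M] [SecondCountableTopology M]
    [ChartedSpace (EuclideanSpace ℝ (Fin 4)) M] [IsManifold (𝓡 4) ∞ M] [CompactSpace M] [T3Space M]
    [MeasurableSpace M] [BorelSpace M],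
    M ≃ₕ Metric.sphere (0 : EuclideanSpace ℝ (Fin 5)) 1 → ∀ ε : ℝ, 0 < ε →
    ∃ g : PseudoRiemannianMetric (𝓡 4) ∞ (EuclideanSpace ℝ (Fin 4)) (TangentSpace (𝓡 4) : M → Type _),
      ∃ _ : g.HasLeviCivita, ∃ hg : g.IsRiemannian, (∀ x : M, 0 < g.scalarCurvature x) ∧
        ∀ τ : ℝ, 0 < τ → ∀ f : M → ℝ, ContMDiff (𝓡 4) 𝓘(ℝ, ℝ) ∞ f →
          ∫ x, (4 * Real.pi * τ) ^ (-(4 : ℝ) / 2) * Real.exp (-f x)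
            ∂(riemannianMeasure (g.toContMDiffRiemannianMetric hg)) = 1 →
          Real.log 6 - 2 - ε ≤
            ∫ x, (τ * (g.scalarCurvature x + g.gradSq f x) + f x - 4) *
              ((4 * Real.pi * τ) ^ (-(4 : ℝ) / 2) * Real.exp (-f x))
              ∂(riemannianMeasure (g.toContMDiffRiemannianMetric hg))

/-- `NearRoundEntropy → ENT`: take `ε = δ = 0.013`, inside the certified window
`0.026 < ν_round − ν_cyl` (`Negative.margin_gt`). -/
theorem subcylindricalExistence_of_nearRoundEntropy (h : NearRoundEntropy) : SubcylindricalExistence := by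
  intro M _ _ _ _ _ _ _ _ _ e
  obtain ⟨g, hLC, hg, hR, hW⟩ := h M e (13 / 1000) (by norm_num)
  refine ⟨g, hLC, hg, hR, 13 / 1000, by norm_num, fun τ hτ f hf hnorm ↦ ?_⟩
  have hwin := Summit.SmoothPoincare4.Cruxes.SubcylindricalExistence.Negative.margin_gt
  have h1 := hW τ hτ f hf hnorm
  linarith

/-! ## §3 Numbers behind two diagnoses -/

/-- **Yamabe blindness, the number.** The Jensen + conformal-Sobolev floor `ν(g) ≥ 2 log (Y(M,[g])/12π) − 2`
(valid for `R ≥ 0`) evaluated at the largest possible Yamabe constant `Y(S⁴) = 12·(8π²/3)^{1/2}`, i.e.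
`Y/12π = √(8/3)`, is `log (8/3) − 2 < −1 < ν_cyl ≈ −0.2345`: conformal/Yamabe data cannot certify ENT's
strict threshold (and cannot be improved to do so: `Y(S³ × S¹_L) → Y(S⁴)` as `L → ∞` while those metrics
contain necks). Uses `e > 8/3`, `log 2 > 0.69`, `log π > 0`. -/
theorem jensenYamabeFloor_lt : Real.log (8 / 3) - 2 < Real.log 2 + Real.log Real.pi / 2 - 3 / 2 := by
  have h1 : Real.log (8 / 3) < 1 := by
    have h83 : (8 / 3 : ℝ) < Real.exp 1 := by
      have := Real.exp_one_gt_d9; linarith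
    have h := Real.log_lt_log (by norm_num) h83
    rwa [Real.log_exp] at h
  have h2 : (0.69 : ℝ) < Real.log 2 := by
    have := Real.log_two_gt_d9; linarith
  have h3 : 0 < Real.log Real.pi := Real.log_pos (by have := Real.pi_gt_three; linarith)
  linarith

/-- The surgery-cost lattice against the thresholds (certified in `Negative/Window.lean`):
`ν_sheet = log 2 − 1 < ν_cyl < ν_round = log 6 − 2`, with `ν_cyl − ν_sheet > 0.072` and
`0.026 < ν_round − ν_cyl < 0.0263`. A 1-surgery handle (modelled on `S²×ℝ²`) sits 0.072 below ENT's
threshold; a 0-surgery neck (modelled on `S³×ℝ`) sits exactly AT it, so a strict inequality is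
unreachable by any construction that passes through a neck or a handle. -/
example : (Real.log 2 - 1) < (Real.log 2 + Real.log Real.pi / 2 - 3 / 2) ∧
    (Real.log 2 + Real.log Real.pi / 2 - 3 / 2) < (Real.log 6 - 2) ∧
    (0.072 : ℝ) < (Real.log 2 + Real.log Real.pi / 2 - 3 / 2) - (Real.log 2 - 1) :=
  ⟨Summit.SmoothPoincare4.Cruxes.SubcylindricalExistence.Negative.nuSheet_lt_nuCyl,
    Summit.SmoothPoincare4.Cruxes.SubcylindricalExistence.Negative.nuCyl_lt_nuRound,
    Summit.SmoothPoincare4.Cruxes.SubcylindricalExistence.Negative.nuCyl_sub_nuSheet_gt⟩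

end Summit.SmoothPoincare4.SmoothPoincare4.Cruxes.SubcylindricalExistence.StrategyCensus

end
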